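import Summits.BirchSwinnertonDyer.BirchSwinnertonDyer.Theorems.BiquadraticEisensteinDescentControlCMInertBadAdmOtherAdditiveCount
import Summits.BirchSwinnertonDyer.BirchSwinnertonDyer.Theorems.EisensteinPrimesBSDpOnCellCLogSymmetry
import Summits.BirchSwinnertonDyer.Rank1Residual.X11b.BDPRouteOnTreeStepL
import Summits.BirchSwinnertonDyer.Rank1Residual.X12.CMIrreducible
import Literature.NumberTheory.EllipticCurves.ComplexMultiplicationNotSemistable
import HarnessLib

/-!
# Route `BiquadraticEisensteinDescent`, crux C — the control bodies WITHOUT the admissibility binder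
# (director-bsd ruling W-16 «Δ-h⁻», 2026-08-27T15:15:08Z), BY VALUE — no `Theses` import (file C″)

Seat `bsd-wall-bed-p2` (prover g7, cell `bsd-wall`, rung W-ALL row 12 · K12i). Theorems only; no definition, no
named fact, no `sorry`. Companion of `…ControlCMInertBadAdmOtherBody` (bed-p3, p525377: `c9B`, `c9A`), whose two
theorems carry — and never use — the quartic class-number binder
`(∀ L quartic, √d_CM ∈ L → √d_K′ ∈ L → ¬ p ∣ h(L)) →` of the K′-supply crux KS (stmt-20198). The director's ruling
W-16 adopts Δ-h⁻: KS is superseded by its K′-form KS_R (`… ∧ ¬ p ∣ h(K′)`), and the deciding theorem `closes` is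
re-pointed through control / frame statements that do not ask for the quartic binder. This file supplies the two
control bodies in BOTH candidate shapes, so that whichever text the route author files, the closer is one line:

* `c10B` — `c9B` with the quartic binder DELETED (fact-free: `rank_ℤ E(K′) = 1 → Ш(E/K′) finite → P non-torsion →`
  after `¬ (p : ℤ) ∣ Dt.c →`); proof = the proof of `c9B` verbatim (additive torsion-weighted Selmer count
  `…AdditiveCount.additiveSelmerCardBoundTorsion_of_rankOne`, control count
  `…exists_hasCharValuationAt_le_of_selmerCardBound_torsion` at the strict prime `𝔭′`, log-embedding symmetry).
* `c10A` — `c9A` with the quartic binder DELETED: `(∀ N W K, gross_zagier N W K) → (∀ N W K, kolyvagin N W K) →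
  hasEntireLFunction_rat →` body; proof: Heegner point non-torsion (GZ), rank one and `Ш` finite (Kolyvagin), `c10B`.
* `c10BK`, `c10AK` — the same two with `¬ p ∣ NumberField.classNumber K →` in the binder's slot (the literal Δ-h⁻
  weakening «p ∤ h(M) for every quartic M» ↦ «p ∤ h(K′)»); one-liners over `c10B` / `c10A`.

Nothing here uses a class number: the control inequality at the additive prime is insensitive to `h(K′)`.
CONDITIONAL only through the displayed antecedents; nothing booked; no label moves. BSD is not proved by this file.
References: [JetchevSkinnerWan2017] Thm. 3.3.1, §7.4.1 (arXiv:1512.06894 pp. 11, 30); [GreenbergLNM1716] §3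
Lemma 3.3, §4 Lemma 4.2; [Gross1991] (1.1), Thm. 1.3; [Kolyvagin1990] Thm. A; [Mazur1978] §6 Prop. 6.3 (1).
-/

noncomputable section

open scoped Classical

open WeierstrassCurve NumberField IsDedekindDomain Field
open Literature.NumberTheory.EllipticCurves Literature.NumberTheory.EllipticCurves.Rank1Residual
  Summit.BirchSwinnertonDyer.Rank1Residual
  Summit.BirchSwinnertonDyer.Rank1Residual.X11b
  Summit.BirchSwinnertonDyer.Rank1Residual.X11b.AcSelmer
  Summit.BirchSwinnertonDyer.BirchSwinnertonDyer.Theorems.BiquadraticEisensteinDescentControlCMInertBadAdmOtherAdditiveCount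

set_option linter.dupNamespace false

namespace Summit.BirchSwinnertonDyer.BirchSwinnertonDyer.Theorems.ControlCMInertBadKPrimeOtherBody

/-- **C″, variant B (fact-free, NO class-number binder), BY VALUE**: for a CM curve `W/ℚ` of analytic rank
one, `p ≥ 5` inert in the CM field and bad, a Heegner datum over an imaginary quadratic `K′` (Heegner hypothesis,
`|d_K′| > 4`, `p ∤ c`), GRANTED `rank_ℤ E(K′) = 1`, `Ш(E/K′)` finite and `P` non-torsion: for every anticyclotomic
`(κ, γ)`, degree-one `𝔭 ∋ p` and the other prime `𝔭′ ∋ p`, `X_{𝔭′}` is `Λ`-torsion with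
`ord_p f(0) = n ≤ ord_p #Ш[p^∞] + 2·(ord_p log_{ω,𝔭} P − ord_p [E(K′):ℤP]) + ord_p ∏_{w ∣ N⁺} c_w`. Same proof as
`ControlCMInertBadAdmOtherBody.c9B` (which binds the quartic class-number hypothesis unused).
[cite: JetchevSkinnerWan2017, Thm. 3.3.1 and §7.4.1 (arXiv:1512.06894 pp. 11, 30)]
[cite: GreenbergLNM1716, §3 Lemma 3.3, §4 Lemma 4.2] [cite: Mazur1978, §6 Prop. 6.3 (1) (p. 153)] -/
theorem c10B :
    ∀ (W : WeierstrassCurve ℚ) [W.IsElliptic] [W.IsGloballyMinimal] (p : ℕ) [Fact p.Prime] [NeZero (W.conductorNorm ℤ)] (K : Type) [Field K] [NumberField K] (Dt : Literature.NumberTheory.EllipticCurves.ModularForms.ModularParametrizationData W (W.conductorNorm ℤ)) (H : Literature.NumberTheory.EllipticCurves.HeegnerDatum (W.conductorNorm ℤ) (NumberField.discr K)) (ι : K →+* ℂ) (P : (W.baseChange K).toAffine.Point), W.HasCM → W.analyticRank = 1 → 5 ≤ p → Literature.NumberTheory.EllipticCurves.Rank1Residual.CMInert W p → ¬ Literature.NumberTheory.EllipticCurves.Rank1Residual.Good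 W p → Literature.NumberTheory.EllipticCurves.IsImaginaryQuadratic K → Literature.NumberTheory.EllipticCurves.SatisfiesHeegnerHypothesis (W.conductorNorm ℤ) K → 4 < (NumberField.discr K).natAbs → WeierstrassCurve.Affine.Point.map ι.toRatAlgHom P = Literature.NumberTheory.EllipticCurves.ModularForms.heegnerPointComplex Dt H → ¬ (p : ℤ) ∣ Dt.c → (W.baseChange K).mordellWeilRank = 1 → (W.baseChange K).ShaFinite → ¬ IsOfFinAddOrder P → (W.quadraticTwist (NumberField.discr K : ℚ)).entireLFunction 1 ≠ 0 → ∀ (κ : Literature.NumberTheory.EllipticCurves.ZpExtension K p), κ.IsAnticyclotomic → ∀ (γ : Field.absoluteGaloisGroup K) [Fact (κ.IsTopGenerator γ)] (𝔭 : IsDedekindDomain.HeightOneSpectrum (NumberField.RingOfIntegers K)) (h𝔭 : ((p : ℕ) : NumberField.RingOfIntegers K) ∈ 𝔭.asIdeal) (he : 𝔭.asIdeal.ramificationIdx (NumberField.RingOfIntegers ℚ) = 1) (hf : 𝔭.asIdeal.inertiaDeg (NumberField.RingOfIntegers ℚ) = 1) (𝔭' : IsDedekindDomain.HeightOneSpectrum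 (NumberField.RingOfIntegers K)) (_ : ((p : ℕ) : NumberField.RingOfIntegers K) ∈ 𝔭'.asIdeal) (_ : 𝔭' ≠ 𝔭), ∃ n : ℕ, Summit.BirchSwinnertonDyer.Rank1Residual.X11b.AcSelmer.XAc.HasCharValuationAt (W.baseChange K) p κ 𝔭' ∅ γ n ∧ (n : ℤ) ≤ (padicValNat p (Nat.card (AddCommGroup.primaryComponent (W.baseChange K).sha p)) : ℤ) + 2 * (Summit.BirchSwinnertonDyer.Rank1Residual.X11b.padicLogOrd W p (Summit.BirchSwinnertonDyer.Rank1Residual.X11b.embAt K p 𝔭 h𝔭 he hf) P - (padicValNat p (AddSubgroup.zmultiples P).index : ℤ)) + padicValNat p (Summit.BirchSwinnertonDyer.Rank1Residual.X11b.tamagawaProductSplit W K) := by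
  intro W _ _ p _ _ K _ _ Dt H ι P hCM _hr hp5 hin hbad hK hHN _hd4 _hP _hc hrank hSha hPinf
    _hLt κ hκ γ _ 𝔭 h𝔭 he hf 𝔭' h𝔭' _hne
  have hp2 : p ≠ 2 := by omega
  haveI : IsTotallyComplex K := hK.2
  have hadd : Addv W p := ⟨hbad, not_mult_of_hasCM W hCM p⟩
  have hivK : ∀ x : (W.baseChange K).toAffine.Point, p • x = 0 → x = 0 :=
    Transvection.forall_torsion_eq_zero_of_irr W p (X12.irr_of_not_cmRamified W p hp2 hin.1) K hK.1
  have hpN : p ∣ W.conductorNorm ℤ := (W.dvd_conductorNorm_iff_not_hasGoodReductionAtPrime p).mpr hbad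
  have hsplit : SplitsIn K p := hHN p Fact.out hpN
  obtain ⟨he', hf'⟩ := degreeOne_of_splitsIn hK.1 hsplit h𝔭'
  -- the count and the control count at the strict prime `𝔭′`
  obtain ⟨hfinSel, a, ha, hale⟩ := additiveSelmerCardBoundTorsion_of_rankOne W p K hadd hK hsplit
    hivK hrank hSha P hPinf 𝔭' h𝔭' he' hf'
  haveI := hfinSel
  obtain ⟨n, hn, hnle⟩ := exists_hasCharValuationAt_le_of_selmerCardBound_torsion (γ := γ) hK.1 hκ
    h𝔭' he' hf' hsplit hpN ha
  refine ⟨n, hn, ?_⟩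
  have hZ : (n : ℤ) + padicValNat p (tamagawaProductAbove W K p) ≤
      a + padicValNat p (tamagawaProductSplit W K) := by exact_mod_cast hnle
  -- the log read at `𝔭`
  rw [LogSymmetry.padicLogOrd_eq_of_finrank_eq_two W p hp2 hK.1 (embAt K p 𝔭 h𝔭 he hf)
    (embAt K p 𝔭' h𝔭' he' hf') hrank P hPinf] at hale
  linarith

/-- **C″, variant A (facts FIRST, NO class-number binder), BY VALUE**: `(∀ N W K, gross_zagier N W K) →
(∀ N W K, kolyvagin N W K) → hasEntireLFunction_rat →` the control statement of `c10B` without its rank / `Ш` /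
non-torsion antecedents (conjuncts 1, 2, 5 of the route's `PublishedInputsBiquadratic`). Proof: the Heegner point
is non-torsion (Gross–Zagier at analytic rank one with `L(E^{d_K′},1) ≠ 0`), hence rank one and `Ш` finite
(Kolyvagin); then `c10B`. Same proof as `ControlCMInertBadAdmOtherBody.c9A` minus the unused binder.
[cite: Gross1991, (1.1) and Thm. 1.3] [cite: Kolyvagin1990, Thm. A]
[cite: JetchevSkinnerWan2017, Thm. 3.3.1 and §7.4.1 (arXiv:1512.06894 pp. 11, 30)] -/
theorem c10A :
    (∀ (N : ℕ) [NeZero N] (W : WeierstrassCurve ℚ) (K : Type) [Field K] [NumberField K], Literature.NumberTheory.EllipticCurves.gross_zagier N W K) → (∀ (N : ℕ) [NeZero N] (W : WeierstrassCurve ℚ) (K : Type) [Field K] [NumberField K], Literature.NumberTheory.EllipticCurves.kolyvagin N W K) → WeierstrassCurve.hasEntireLFunction_rat → ∀ (W : WeierstrassCurve ℚ) [W.IsElliptic] [W.IsGloballyMinimal] (p : ℕ) [Fact p.Prime] [NeZero (W.conductorNorm ℤ)] (K : Type) [Field K] [NumberField K] (Dt : Literature.NumberTheory.EllipticCurves.ModularForms.ModularParametrizationData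 W (W.conductorNorm ℤ)) (H : Literature.NumberTheory.EllipticCurves.HeegnerDatum (W.conductorNorm ℤ) (NumberField.discr K)) (ι : K →+* ℂ) (P : (W.baseChange K).toAffine.Point), W.HasCM → W.analyticRank = 1 → 5 ≤ p → Literature.NumberTheory.EllipticCurves.Rank1Residual.CMInert W p → ¬ Literature.NumberTheory.EllipticCurves.Rank1Residual.Good W p → Literature.NumberTheory.EllipticCurves.IsImaginaryQuadratic K → Literature.NumberTheory.EllipticCurves.SatisfiesHeegnerHypothesis (W.conductorNorm ℤ) K → 4 < (NumberField.discr K).natAbs → WeierstrassCurve.Affine.Point.map ι.toRatAlgHom P = Literature.NumberTheory.EllipticCurves.ModularForms.heegnerPointComplex Dt H → ¬ (p : ℤ) ∣ Dt.c → (W.quadraticTwist (NumberField.discr K : ℚ)).entireLFunction 1 ≠ 0 → ∀ (κ : Literature.NumberTheory.EllipticCurves.ZpExtension K p), κ.IsAnticyclotomic → ∀ (γ : Field.absoluteGaloisGroup K) [Fact (κ.IsTopGenerator γ)] (𝔭 : IsDedekindDomain.HeightOneSpectrum (NumberField.RingOfIntegers K)) (h𝔭 : ((p : ℕ) : NumberField.RingOfIntegers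 K) ∈ 𝔭.asIdeal) (he : 𝔭.asIdeal.ramificationIdx (NumberField.RingOfIntegers ℚ) = 1) (hf : 𝔭.asIdeal.inertiaDeg (NumberField.RingOfIntegers ℚ) = 1) (𝔭' : IsDedekindDomain.HeightOneSpectrum (NumberField.RingOfIntegers K)) (_ : ((p : ℕ) : NumberField.RingOfIntegers K) ∈ 𝔭'.asIdeal) (_ : 𝔭' ≠ 𝔭), ∃ n : ℕ, Summit.BirchSwinnertonDyer.Rank1Residual.X11b.AcSelmer.XAc.HasCharValuationAt (W.baseChange K) p κ 𝔭' ∅ γ n ∧ (n : ℤ) ≤ (padicValNat p (Nat.card (AddCommGroup.primaryComponent (W.baseChange K).sha p)) : ℤ) + 2 * (Summit.BirchSwinnertonDyer.Rank1Residual.X11b.padicLogOrd W p (Summit.BirchSwinnertonDyer.Rank1Residual.X11b.embAt K p 𝔭 h𝔭 he hf) P - (padicValNat p (AddSubgroup.zmultiples P).index : ℤ)) + padicValNat p (Summit.BirchSwinnertonDyer.Rank1Residual.X11b.tamagawaProductSplit W K) := by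
  intro hGZ hKo hmod W _ _ p _ _ K _ _ Dt H ι P hCM hr hp5 hin hbad hK hHN hd4 hP hc hLt κ hκ γ _ 𝔭
    h𝔭 he hf 𝔭' h𝔭' hne
  have hPinf : ¬ IsOfFinAddOrder P :=
    not_isOfFinAddOrder_of_heegner_of_analyticRank_eq_one W (W.conductorNorm ℤ) K Dt H ι P
      (hGZ _ W K) hmod hr hK hHN hLt hP
  obtain ⟨hrank, hSha⟩ := hKo (W.conductorNorm ℤ) W K hK hHN ⟨Dt, H, ι, hP⟩ hPinf
  exact c10B W p K Dt H ι P hCM hr hp5 hin hbad hK hHN hd4 hP hc hrank hSha hPinf hLt κ hκ γ 𝔭 h𝔭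
    he hf 𝔭' h𝔭' hne

/-- **C″, variant B in the literal Δ-h⁻ shape**: `c10B` with `¬ p ∣ h(K′) →` in the slot of the old quartic
class-number binder (unused — the control inequality does not see class numbers). One line over `c10B`.
[cite: JetchevSkinnerWan2017, Thm. 3.3.1 and §7.4.1 (arXiv:1512.06894 pp. 11, 30)] -/
theorem c10BK :
    ∀ (W : WeierstrassCurve ℚ) [W.IsElliptic] [W.IsGloballyMinimal] (p : ℕ) [Fact p.Prime] [NeZero (W.conductorNorm ℤ)] (K : Type) [Field K] [NumberField K] (Dt : Literature.NumberTheory.EllipticCurves.ModularForms.ModularParametrizationData W (W.conductorNorm ℤ)) (H : Literature.NumberTheory.EllipticCurves.HeegnerDatum (W.conductorNorm ℤ) (NumberField.discr K)) (ι : K →+* ℂ) (P : (W.baseChange K).toAffine.Point), W.HasCM → W.analyticRank = 1 → 5 ≤ p → Literature.NumberTheory.EllipticCurves.Rank1Residual.CMInert W p → ¬ Literature.NumberTheory.EllipticCurves.Rank1Residual.Good W p → Literature.NumberTheory.EllipticCurves.IsImaginaryQuadratic K → Literature.NumberTheory.EllipticCurves.SatisfiesHeegnerHypothesis (W.conductorNorm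 ℤ) K → 4 < (NumberField.discr K).natAbs → ¬ p ∣ NumberField.classNumber K → WeierstrassCurve.Affine.Point.map ι.toRatAlgHom P = Literature.NumberTheory.EllipticCurves.ModularForms.heegnerPointComplex Dt H → ¬ (p : ℤ) ∣ Dt.c → (W.baseChange K).mordellWeilRank = 1 → (W.baseChange K).ShaFinite → ¬ IsOfFinAddOrder P → (W.quadraticTwist (NumberField.discr K : ℚ)).entireLFunction 1 ≠ 0 → ∀ (κ : Literature.NumberTheory.EllipticCurves.ZpExtension K p), κ.IsAnticyclotomic → ∀ (γ : Field.absoluteGaloisGroup K) [Fact (κ.IsTopGenerator γ)] (𝔭 : IsDedekindDomain.HeightOneSpectrum (NumberField.RingOfIntegers K)) (h𝔭 : ((p : ℕ) : NumberField.RingOfIntegers K) ∈ 𝔭.asIdeal) (he : 𝔭.asIdeal.ramificationIdx (NumberField.RingOfIntegers ℚ) = 1) (hf : 𝔭.asIdeal.inertiaDeg (NumberField.RingOfIntegers ℚ) = 1) (𝔭' : IsDedekindDomain.HeightOneSpectrum (NumberField.RingOfIntegers K)) (_ : ((p : ℕ) : NumberField.RingOfIntegers K) ∈ 𝔭'.asIdeal)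 (_ : 𝔭' ≠ 𝔭), ∃ n : ℕ, Summit.BirchSwinnertonDyer.Rank1Residual.X11b.AcSelmer.XAc.HasCharValuationAt (W.baseChange K) p κ 𝔭' ∅ γ n ∧ (n : ℤ) ≤ (padicValNat p (Nat.card (AddCommGroup.primaryComponent (W.baseChange K).sha p)) : ℤ) + 2 * (Summit.BirchSwinnertonDyer.Rank1Residual.X11b.padicLogOrd W p (Summit.BirchSwinnertonDyer.Rank1Residual.X11b.embAt K p 𝔭 h𝔭 he hf) P - (padicValNat p (AddSubgroup.zmultiples P).index : ℤ)) + padicValNat p (Summit.BirchSwinnertonDyer.Rank1Residual.X11b.tamagawaProductSplit W K) := by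
  intro W _ _ p _ _ K _ _ Dt H ι P hCM hr hp5 hin hbad hK hHN hd4 _hh hP hc hrank hSha hPinf hLt κ hκ γ _ 𝔭
    h𝔭 he hf 𝔭' h𝔭' hne
  exact c10B W p K Dt H ι P hCM hr hp5 hin hbad hK hHN hd4 hP hc hrank hSha hPinf hLt κ hκ γ 𝔭 h𝔭 he hf
    𝔭' h𝔭' hne

/-- **C″, variant A in the literal Δ-h⁻ shape**: `c10A` with `¬ p ∣ h(K′) →` in the slot of the old quartic
class-number binder (unused). One line over `c10A`. [cite: Gross1991, (1.1) and Thm. 1.3] [cite: Kolyvagin1990, Thm. A]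
[cite: JetchevSkinnerWan2017, Thm. 3.3.1 and §7.4.1 (arXiv:1512.06894 pp. 11, 30)] -/
theorem c10AK :
    (∀ (N : ℕ) [NeZero N] (W : WeierstrassCurve ℚ) (K : Type) [Field K] [NumberField K], Literature.NumberTheory.EllipticCurves.gross_zagier N W K) → (∀ (N : ℕ) [NeZero N] (W : WeierstrassCurve ℚ) (K : Type) [Field K] [NumberField K], Literature.NumberTheory.EllipticCurves.kolyvagin N W K) → WeierstrassCurve.hasEntireLFunction_rat → ∀ (W : WeierstrassCurve ℚ) [W.IsElliptic] [W.IsGloballyMinimal] (p : ℕ) [Fact p.Prime] [NeZero (W.conductorNorm ℤ)] (K : Type) [Field K] [NumberField K] (Dt : Literature.NumberTheory.EllipticCurves.ModularForms.ModularParametrizationData W (W.conductorNorm ℤ)) (H : Literature.NumberTheory.EllipticCurves.HeegnerDatum (W.conductorNorm ℤ) (NumberField.discr K)) (ι : K →+* ℂ) (P : (W.baseChange K).toAffine.Point), W.HasCM → W.analyticRank = 1 → 5 ≤ p → Literature.NumberTheory.EllipticCurves.Rank1Residual.CMInert W p → ¬ Literature.NumberTheory.EllipticCurves.Rank1Residual.Good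 W p → Literature.NumberTheory.EllipticCurves.IsImaginaryQuadratic K → Literature.NumberTheory.EllipticCurves.SatisfiesHeegnerHypothesis (W.conductorNorm ℤ) K → 4 < (NumberField.discr K).natAbs → ¬ p ∣ NumberField.classNumber K → WeierstrassCurve.Affine.Point.map ι.toRatAlgHom P = Literature.NumberTheory.EllipticCurves.ModularForms.heegnerPointComplex Dt H → ¬ (p : ℤ) ∣ Dt.c → (W.quadraticTwist (NumberField.discr K : ℚ)).entireLFunction 1 ≠ 0 → ∀ (κ : Literature.NumberTheory.EllipticCurves.ZpExtension K p), κ.IsAnticyclotomic → ∀ (γ : Field.absoluteGaloisGroup K) [Fact (κ.IsTopGenerator γ)] (𝔭 : IsDedekindDomain.HeightOneSpectrum (NumberField.RingOfIntegers K)) (h𝔭 : ((p : ℕ) : NumberField.RingOfIntegers K) ∈ 𝔭.asIdeal) (he : 𝔭.asIdeal.ramificationIdx (NumberField.RingOfIntegers ℚ) = 1) (hf : 𝔭.asIdeal.inertiaDeg (NumberField.RingOfIntegers ℚ) = 1) (𝔭' : IsDedekindDomain.HeightOneSpectrum (NumberField.RingOfIntegers K)) (_ : ((p : ℕ) : NumberField.RingOfIntegers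 K) ∈ 𝔭'.asIdeal) (_ : 𝔭' ≠ 𝔭), ∃ n : ℕ, Summit.BirchSwinnertonDyer.Rank1Residual.X11b.AcSelmer.XAc.HasCharValuationAt (W.baseChange K) p κ 𝔭' ∅ γ n ∧ (n : ℤ) ≤ (padicValNat p (Nat.card (AddCommGroup.primaryComponent (W.baseChange K).sha p)) : ℤ) + 2 * (Summit.BirchSwinnertonDyer.Rank1Residual.X11b.padicLogOrd W p (Summit.BirchSwinnertonDyer.Rank1Residual.X11b.embAt K p 𝔭 h𝔭 he hf) P - (padicValNat p (AddSubgroup.zmultiples P).index : ℤ)) + padicValNat p (Summit.BirchSwinnertonDyer.Rank1Residual.X11b.tamagawaProductSplit W K) := by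
  intro hGZ hKo hmod W _ _ p _ _ K _ _ Dt H ι P hCM hr hp5 hin hbad hK hHN hd4 _hh hP hc hLt κ hκ γ _ 𝔭
    h𝔭 he hf 𝔭' h𝔭' hne
  exact c10A hGZ hKo hmod W p K Dt H ι P hCM hr hp5 hin hbad hK hHN hd4 hP hc hLt κ hκ γ 𝔭 h𝔭 he hf
    𝔭' h𝔭' hne

end Summit.BirchSwinnertonDyer.BirchSwinnertonDyer.Theorems.ControlCMInertBadKPrimeOtherBody

end
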